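import Mathlib
import HarnessLib
import Summits.HubbardSuperconductivity.HubbardSuperconductivity.Theorems.KLProgrammeKLRegimeEngineScaleZeroV17FRaise
import Summits.HubbardSuperconductivity.HubbardSuperconductivity.Theorems.KLProgrammeKLRegimeEngineTwoLegStepV17F2ZeroCloserRaise
import Summits.HubbardSuperconductivity.HubbardSuperconductivity.Theorems.KLProgrammeKLRegimeEngineValueClausesV17FRaise
import Summits.HubbardSuperconductivity.HubbardSuperconductivity.Theorems.KLProgrammeKLRegimeEngineV8DefsG11
import Summits.HubbardSuperconductivity.HubbardSuperconductivity.Theorems.KLProgrammeKLRegimeEngineV8DefsQ9c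
import Summits.HubbardSuperconductivity.HubbardSuperconductivity.Theorems.KLProgrammeKLRegimeEngineV8DefsU10
import Summits.HubbardSuperconductivity.HubbardSuperconductivity.Theorems.KLProgrammeKLRegimeEngineV8DefsL4
import Summits.HubbardSuperconductivity.HubbardSuperconductivity.Theorems.KLProgrammeKLRegimeTwoLegCurvatureConstsJetC2

/-!
# Route `KLProgramme` — ENGINE child gen 8 (stmt-HubbardSuperconductivity-20437 `KLRegimeEngineV17F2`), skeleton v2 token-only stubs (a)/(M):
# their closers AT THE rev-13 TOKENS `(klEngGeo11, klEngQ9c P R)` — geometry-generic transport of the scale-`0` conjunction + the two instances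
# (cell gate-hubbard-kl, seat p1b g14 — 20437 registrant lineage, (M) owner; the (a) lineage k3c2-p1 is unseated)

WHY.  The v2 FREEZE image-elect (rev 13 «r10TB3C5Q9cE-REL5-G10-MOM-CAP6-G11-REL7», sha16 c6c418fe3121960f) keys the seven stubs at the geometry token
`klEngGeo11 := ((klEngGeo8.addShellLog 2⁵²).raiseCF klE5CFM).addTwoShell klTSA` (…EngineV8DefsG11) and the engine package `klEngQ9c P R` (a raise of `klEngQ7 P R`,
`isRaiseOf_klEngQ9c`).  The landed (a) closers stop at `klEngGeo8` (`stub_engine_scale0_klEng8_raise`, …ScaleZeroV17FRaise; `…RaiseG` covers `klEngGeo8.raise T E`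
only, which `addShellLog`/`raiseCF`/`addTwoShell` are not), and the image's §Z notes defer «re-keying to the token» to closer-side work.  This file does that work
ONCE, geometry-generically, so every later `G`-token move costs three `rfl`/`≤` rows:

* §1 **`scaleZeroConjV17F2_transport_geo`** — the five-clause conclusion of stub (a) transports from `G` to ANY `G'` with `initDevBar G' U = initDevBar G U`
  (i.e. `atop/abot` read through `initDevBar` only), `G.cE4 ≤ G'.cE4`, `G.CF ≤ G'.CF` (`0 ≤ P.Klam`): (E1-v4)₀ does not read `G`; (E2-F2)₀ and (E2′-F UV)₀ read `G`
  only through `initDevBar G U` at `n = 0` (`pairLadderStepAtV17F2_zero_of_initDevBar_eq`, `quarticValueUVAtV17F_zero_of_initDevBar_eq` — the `1 ≤ n` branch is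
  void, `legDressBarQ2` ignores `G`); (E4)₀ by `engineFirstMoments_mono`; (E5-F)₀ by `isoTupleL1AtV17F_mono`.
* §2 **`stub_engine_scale0_geo_of_klEng8`** — stub (a) under the v2 binders (`c ≤ klEngC₃6 P R`, `U ≤ klEngU₀10 P R c`, `klEngL₄ P R β U ≤ L`) at `(G, QT P R)` for
  ANY `G` that is `initDevBar`-, `cE4`-, `CF`-compatible with `klEngGeo8` and any raise family `QT` of `klEngQ7`.
* §3 the instances at the rev-13 tokens: **`stub_engine_scale0_klEng11Q9c_U10L4`** (a) and **`stub_twoLeg_scale0_klEng11Q9c_U10L4`** (M) — the latter is p1b g10's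
  `G`-generic `stub_twoLeg_scale0_raise_G` at `G := klEngGeo11` (it reads `G` only through `G.S = klEngGeo8.S`).  On registration day the (a)/(M) closers at the
  frozen doors `klEngC₃7 ≤ klEngC₃6`, `klEngU₀12 ≤ klEngU₀10` are these two theorems with two `.trans` rows each.

Pure composition over landed modules; no definition; nothing about the model is asserted beyond the cited upstream theorems; nothing asserts any open stub of
20437, the K3 theorem half or superconductivity.  References: BGM 2006 §2–§3 [cite: BenfattoGiulianiMastropietro2006].
-/

noncomputable section

namespace Summit.HubbardSuperconductivity.HubbardSuperconductivity.Theorems.EngineV8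

set_option linter.dupNamespace false -- summit = problem name (single-conjunct summit), D-0017

open Real Finset Literature.MathematicalPhysics.QuantumLattice Literature.Probability.LatticeModels
open Summit.HubbardSuperconductivity.HubbardSuperconductivity.Theorems.KLRegimeSplit
open Summit.HubbardSuperconductivity.HubbardSuperconductivity.Theorems.KLProgrammeLegKernels

/-! ## §1 Geometry-generic transport of the scale-`0` conjunction -/

section Transport

variable {L M : ℕ} [NeZero L] [NeZero M] {G G' : GeoConsts} {P : SplitConsts} {Q : EngConsts} {β U μ : ℝ}

/-- **(E2-F2)₀ is `initDevBar`-determined**: at `n = 0` the cured ladder clause reads `G` only through `initDevBar G U` (the `1 ≤ n` branch is void and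
`legDressBarQ2` ignores `G`). -/
theorem pairLadderStepAtV17F2_zero_of_initDevBar_eq (hG : initDevBar G' U = initDevBar G U) (h : PairLadderStepAtV17F2 L M G P Q β U μ 0) :
    PairLadderStepAtV17F2 L M G' P Q β U μ 0 := by
  refine ⟨fun hn Qm k hk k' hk' => ?_, fun hn => absurd hn (by norm_num)⟩
  have := h.1 hn Qm k hk k' hk'
  rw [hG]
  exact this

/-- **(E2′-F UV)₀ is `initDevBar`-determined** (reads `G` only through `initDevBar G U`; `legDressBarQ2` ignores `G`). -/
theorem quarticValueUVAtV17F_zero_of_initDevBar_eq (hG : initDevBar G' U = initDevBar G U) (h : QuarticValueUVAtV17F L M G P Q β U μ 0) :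
    QuarticValueUVAtV17F L M G' P Q β U μ 0 := by
  intro hn k₁ hk₁ k₂ hk₂ k₃ hk₃
  have := h hn k₁ hk₁ k₂ hk₂ k₃ hk₃
  rw [hG]
  exact this

/-- **The five-clause conclusion of stub (a) transports along any `initDevBar`-idle, `cE4`/`CF`-raising change of geometry package `G ↦ G'`** (`0 ≤ P.Klam`):
(E1-v4)₀ does not read `G`; (E2-F2)₀/(E2′-F UV)₀ by the `initDevBar` congruences; (E4)₀ by `engineFirstMoments_mono`; (E5-F)₀ by `isoTupleL1AtV17F_mono`. -/
theorem scaleZeroConjV17F2_transport_geo (hID : initDevBar G' U = initDevBar G U) (hE4 : G.cE4 ≤ G'.cE4) (hCF : G.CF ≤ G'.CF) (hK : 0 ≤ P.Klam)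
    (h : KernelNormsV4 L M P Q β U μ (klFlowFrameU L M β U μ 0) 0 ∧ PairLadderStepAtV17F2 L M G P Q β U μ 0 ∧
      QuarticValueUVAtV17F L M G P Q β U μ 0 ∧ EngineFirstMoments L M G P Q β U μ (klFlowFrameU L M β U μ 0) 0 ∧
        IsoTupleL1AtV17F L M G P β U μ 0) :
    KernelNormsV4 L M P Q β U μ (klFlowFrameU L M β U μ 0) 0 ∧ PairLadderStepAtV17F2 L M G' P Q β U μ 0 ∧
      QuarticValueUVAtV17F L M G' P Q β U μ 0 ∧ EngineFirstMoments L M G' P Q β U μ (klFlowFrameU L M β U μ 0) 0 ∧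
        IsoTupleL1AtV17F L M G' P β U μ 0 :=
  ⟨h.1, pairLadderStepAtV17F2_zero_of_initDevBar_eq hID h.2.1, quarticValueUVAtV17F_zero_of_initDevBar_eq hID h.2.2.1,
    engineFirstMoments_mono hE4 hK h.2.2.2.1, isoTupleL1AtV17F_mono hCF h.2.2.2.2⟩

end Transport

/-! ## §2 Stub (a) under the v2 binders at `(G, QT P R)` for any `klEngGeo8`-compatible `G` and any raise family `QT` of `klEngQ7` -/

/-- **STUB (a), GEOMETRY-GENERIC OVER `klEngGeo8`, v2 binders**: for any `G` with `initDevBar G U = initDevBar klEngGeo8 U` (all `U`), `klEngGeo8.cE4 ≤ G.cE4`,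
`klEngGeo8.CF ≤ G.CF`, and any raise family `QT` of `klEngQ7`: under `c ≤ klEngC₃6 P R`, `U ≤ klEngU₀10 P R c`, `klEngL₄ P R β U ≤ L`, `klEngM₃ β U L ≤ M`, bare flow
frame admissible — (E1-v4)₀ ∧ (E2-F2)₀ ∧ (E2′-F UV)₀ ∧ (E4)₀ ∧ (E5-F)₀ at `(G, QT P R)`.  (= `stub_engine_scale0_klEng8_raise` ∘ doors `klEngU₀10 ≤ klEngU₀9`,
`klEngL₃ ≤ klEngL₄` ∘ §1.) -/
theorem stub_engine_scale0_geo_of_klEng8 (G : GeoConsts) (hID : ∀ U : ℝ, initDevBar G U = initDevBar klEngGeo8 U) (hE4 : klEngGeo8.cE4 ≤ G.cE4)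
    (hCF : klEngGeo8.CF ≤ G.CF) (QT : SplitConsts → RenConsts → EngConsts) (hQT : ∀ P R, (klEngQ7 P R).IsRaiseOf (QT P R)) :
    ∀ (P : SplitConsts) (R : RenConsts) (c : ℝ), P.WF → R.WF2 → 0 < c → c ≤ klEngC₃6 P R →
      ∀ μ ∈ klWindowC, ∀ U : ℝ, 0 < U → U ≤ klEngU₀10 P R c → ∀ β : ℝ, klBetaMin ≤ β → β ≤ Real.exp (c / U ^ 2) →
        ∀ (L M : ℕ) [NeZero L] [NeZero M], klEngL₄ P R β U ≤ L → klEngM₃ β U L ≤ M →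
          FrameOK R U (nScales β) μ (klFlowFrameU L M β U μ 0) →
            KernelNormsV4 L M P (QT P R) β U μ (klFlowFrameU L M β U μ 0) 0 ∧
              PairLadderStepAtV17F2 L M G P (QT P R) β U μ 0 ∧
                QuarticValueUVAtV17F L M G P (QT P R) β U μ 0 ∧
                  EngineFirstMoments L M G P (QT P R) β U μ (klFlowFrameU L M β U μ 0) 0 ∧
                    IsoTupleL1AtV17F L M G P β U μ 0 :=
  fun P R c hP hR hc hc₆ μ hμ U hU hU₁₀ β hβ hβc L M _ _ hL hM hK =>
    scaleZeroConjV17F2_transport_geo (hID U) hE4 hCF (zero_le_one.trans hP.1)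
      (stub_engine_scale0_klEng8_raise QT hQT P R c hP hR hc hc₆ μ hμ U hU (hU₁₀.trans (klEngU₀10_le_klEngU₀9 P R c)) β hβ hβc L M
        (klEngL₃_le_of_klEngL₄_le hL) hM hK)

/-! ## §3 The instances at the rev-13 tokens `(klEngGeo11, klEngQ9c P R)` -/

/-- `initDevBar klEngGeo11 U = initDevBar klEngGeo8 U`: the token chain `klEngGeo8 ↦ 9 ↦ 10 ↦ 11` (`addShellLog`, `raiseCF`, `addTwoShell`) does not touch `atop/abot`
(definitional). -/
theorem initDevBar_klEngGeo11 (U : ℝ) : initDevBar klEngGeo11 U = initDevBar klEngGeo8 U := rfl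

/-- `klEngGeo11.cE4 = klEngGeo8.cE4` (the chain is `cE4`-idle; definitional). -/
theorem klEngGeo11_cE4_eq_klEngGeo8 : klEngGeo11.cE4 = klEngGeo8.cE4 := rfl

/-- `klEngGeo11.S = klEngGeo8.S` (the chain is `S`-idle; definitional). -/
theorem klEngGeo11_S_eq_klEngGeo8 : klEngGeo11.S = klEngGeo8.S := rfl

/-- **STUB (a) AT THE rev-13 TOKENS**: under the v2 binders (`c ≤ klEngC₃6 P R`, `U ≤ klEngU₀10 P R c`, `klEngL₄ P R β U ≤ L`, `klEngM₃ β U L ≤ M`, bare flow frame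
admissible) the five scale-`0` clauses at `(klEngGeo11, klEngQ9c P R)`.  The registered-text closer at the frozen doors is this theorem after `hc3.trans (klEngC₃7_le_klEngC₃6 P R)`
and `hUle.trans (klEngU₀12_le_klEngU₀10 P R c)`. -/
theorem stub_engine_scale0_klEng11Q9c_U10L4 :
    ∀ (P : SplitConsts) (R : RenConsts) (c : ℝ), P.WF → R.WF2 → 0 < c → c ≤ klEngC₃6 P R →
      ∀ μ ∈ klWindowC, ∀ U : ℝ, 0 < U → U ≤ klEngU₀10 P R c → ∀ β : ℝ, klBetaMin ≤ β → β ≤ Real.exp (c / U ^ 2) →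
        ∀ (L M : ℕ) [NeZero L] [NeZero M], klEngL₄ P R β U ≤ L → klEngM₃ β U L ≤ M →
          FrameOK R U (nScales β) μ (klFlowFrameU L M β U μ 0) →
            KernelNormsV4 L M P (klEngQ9c P R) β U μ (klFlowFrameU L M β U μ 0) 0 ∧
              PairLadderStepAtV17F2 L M klEngGeo11 P (klEngQ9c P R) β U μ 0 ∧
                QuarticValueUVAtV17F L M klEngGeo11 P (klEngQ9c P R) β U μ 0 ∧
                  EngineFirstMoments L M klEngGeo11 P (klEngQ9c P R) β U μ (klFlowFrameU L M β U μ 0) 0 ∧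
                    IsoTupleL1AtV17F L M klEngGeo11 P β U μ 0 :=
  stub_engine_scale0_geo_of_klEng8 klEngGeo11 initDevBar_klEngGeo11 klEngGeo11_cE4_eq_klEngGeo8.ge klEngGeo8_CF_le_klEngGeo11_CF
    (fun P R => klEngQ9c P R) isRaiseOf_klEngQ9c_family

/-- **STUB (M) AT THE rev-13 TOKENS**: under the v2 binders, the frame/engine/jet-bound hypotheses of (M) at `(klEngGeo11, klEngQ9c P R, klC4aJetC2)` give
`TwoLegStepV17F2 L M klEngGeo11 P (klEngQ9c P R) R β U μ 0` — `stub_twoLeg_scale0_raise_G` (p1b g10, `G`-generic through `G.S`) at `G := klEngGeo11`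
(`klEngGeo11.S = klEngGeo8.S`, table `klC4aJetC2_le_klEngGeo8_S`), `Q := klEngQ9c P R` (`isRaiseOf_klEngQ9c`).  The registered-text closer at the frozen doors is this
theorem after the same two `.trans` rows as for (a). -/
theorem stub_twoLeg_scale0_klEng11Q9c_U10L4 (P : SplitConsts) (R : RenConsts) (c : ℝ) (hP : P.WF) (hR : R.WF2) (hc : 0 < c) (hc3 : c ≤ klEngC₃6 P R)
    (μ : ℝ) (hμ : μ ∈ klWindowC) (U : ℝ) (hU : 0 < U) (hUle : U ≤ klEngU₀10 P R c) (β : ℝ) (hβ : klBetaMin ≤ β) (hβc : β ≤ Real.exp (c / U ^ 2))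
    (L M : ℕ) [NeZero L] [NeZero M] (hL : klEngL₄ P R β U ≤ L) (hM : klEngM₃ β U L ≤ M) (hfr : FrameOK R U (nScales β) μ (klFlowFrameU L M β U μ 0))
    (hE : EngineBoundsAtV17F2 L M klEngGeo11 P (klEngQ9c P R) β U μ 0)
    (hJ : TwoLegReadJetBound L M klC4aJetC2 (klC4aJetC' P R) β U μ (klFlowFrameU L M β U μ 0) 0) :
    TwoLegStepV17F2 L M klEngGeo11 P (klEngQ9c P R) R β U μ 0 :=
  stub_twoLeg_scale0_raise_G klEngGeo11 P R (klEngQ9c P R) (isRaiseOf_klEngQ9c P R) klC4aJetC2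
    (fun k => by rw [klEngGeo11_S_eq_klEngGeo8]; exact klC4aJetC2_le_klEngGeo8_S k) c hP hR hc hc3 μ hμ U hU hUle β hβ hβc L M hL hM hfr hE hJ

end Summit.HubbardSuperconductivity.HubbardSuperconductivity.Theorems.EngineV8

end
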